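import Summits.HodgeConjecture.HodgeConjecture.Theorems.F0P6aLineSpecialisationFibres
import HarnessLib

/-!
# `F0P6aLineSpecialisationGeneric` — ★ RE-HOME of `Lines/F0_P6a_LineSpecialisation.lean` (tree ED. 3 sha16 d6354130763e131e), PART 4 of 6 — tree lines :961–:1285.

See PART 1 `Theorems/F0P6aLineSpecialisationLetters.lean` for the full ★ re-home header and the original module docstring (verbatim there).  Same namespace (every fully-qualified name unchanged);
the scopes open at the cut (`noncomputable section` ∕ `namespace` ∕ `section`s) are re-opened below with their `variable` ∕ `open` ∕ `set_option` ∕ `omit` ∕ `include` ∕ `universe` lines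
replayed verbatim from the tree, in order; the code after the replay block is the tree bytes :961–:1285, untouched.  HC_CM is proved only modulo the 7 printed citations (2 remaining: hLiu418 = stmt-HodgeConjecture-24832, h413 = stmt-HodgeConjecture-24833) until rung 0 closes; a re-home is count-neutral.
-/

-- ── replay of the scopes open at tree line :961 (verbatim) ──
set_option autoImplicit false
set_option linter.dupNamespace false
noncomputable section
namespace Summit.HodgeConjecture.HodgeConjecture.Cruxes.HLiu418.F0P6aLineSpecialisation
open CategoryTheory CategoryTheory.Limits NumberField IsDedekindDomain MulAction AlgebraicGeometry
open scoped Matrix Polynomial Pointwise MonoidalCategory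
open Literature.NumberTheory.GaloisRepresentations
open Literature.NumberTheory.Automorphic Literature.NumberTheory.Automorphic.UnitaryGroup
open Literature.AlgebraicGeometry.ShimuraVarieties.UnitaryCanonicalModel
open Literature.NumberTheory.Automorphic.Liu2021.AppendixC
open Literature.AlgebraicGeometry.Motives (AlgPoints IntegralModel SchemeOver thickening thickeningGalAction thickeningLift specOver extendPoint
  specValuationSubring specFractionFieldι specRingHomι)
open Literature.NumberTheory.DiophantineGeometry (geomResidueField specialFibreFunctor specResidueField geomClosedPointIsoSpecResidueField
  geomResidueFieldEquiv toClosureValuationSubring)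
open Literature.AlgebraicGeometry.RelativeSpec (ActionOver)
open Literature.NumberTheory.EllipticCurves (genericFibre specGenericPoint)
open Literature.AlgebraicGeometry.AbelianSchemes Literature.AlgebraicGeometry.AbelianSchemes.AbelianSchemeOver
open Literature.AlgebraicGeometry.GroupSchemes.AffineGroupScheme (Alg)
open Summit.HodgeConjecture.HodgeConjecture.Cruxes.HLiu418.F0P6aModuliDatumDefs
open Summit.HodgeConjecture.HodgeConjecture.Cruxes.HLiu418.F0P6aRGDAssembly
open Summit.HodgeConjecture.HodgeConjecture.Cruxes.HLiu418.F0P6aDatumOfInputs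
-- ── tree bytes :961–:1285 ──

/-! ### §1b the dock at `red₀ y` IS the special fibre `layerκ I y`, over `A` and `𝒪_F`-equivariantly (PROVED by LA2-p04 (g0), `sec1b.v2` 63f3ed29, merged verbatim) -/

section Special

set_option synthInstance.maxHeartbeats 100000

open Literature.AlgebraicGeometry.GroupSchemes (GroupSchemeKernel.ker GroupSchemeKernel.kerι)

variable {F : Type} [Field F] [NumberField F] [IsCMField F] {ι₁ : F →+* ℂ}
    {Jstar : Matrix (Fin 2) (Fin 2) F}
    {K₀ : C5.OpenCompactSubgroup ↥(finAdelic ↥(maximalRealSubfield F) F (IsCMField.complexConj F) 2 Jstar)}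
    {S : RecordSystemGS F Jstar ι₁ K₀} {hU7ₛ : S.HeckeTranslateDefinedOver}
    {hJ : (Jstar.map (IsCMField.complexConj F))ᵀ = Jstar} {hJu : IsUnit Jstar}
    {Fi : Type} [Field Fi] [Algebra F Fi] {Kc : C5.SmallLevel K₀} {G : Type} [Group G]
    {𝓜 : IntegralModel (𝓞 F) F ((thickening F Fi).obj (S.M.obj Kc))}
    {w : HeightOneSpectrum (𝓞 F)} {hw : (IsCMField.complexConj F) • w ≠ w} {h𝓨 : (𝓜.localise w).IsSmoothProper 1}
    {θ : ActionOver (𝓜.localise w).total.hom ((Fi ≃ₐ[F] Fi) × G)}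
    {e : Fi →ₐ[F] AlgebraicClosure (w.adicCompletion F)}

set_option maxHeartbeats 400000 in
set_option backward.isDefEq.respectTransparency false in
open scoped MonObj CategoryTheory.Obj in
/-- **§1b `exists_iso_dock_layerR` — THE SPECIAL FIBRE `layerκ I y` IS THE DOCK `G₀ (red₀ y)`, OVER `A` AND `𝒪_F`-EQUIVARIANTLY**: an isomorphism of `κ̄(w)`-group schemes
`ε : layerκ I y ≅ (𝔡 (red₀ y)).G₀` (homomorphic) with `ε ≫ ι₀G ≫ (σ2) = (ιR)_κ̄` and `(βR a)_κ̄ ≫ ε = ε ≫ β₀ a` — the dock rows `ι₀G`∕`hkerG₀`∕`hβ₀G` transported along the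
CHOSEN (σ2) iso by `forall_exists_comp_eq_iff_of_iso`, ★ (S-c-β) `exists_equivariant_iso_of_forall_iff` at the family `(famOf I y) ×_R κ̄`, ★ (S-c) §3 `exists_baseChange_iso`,
★ (S-c-β) §3 `pullback_map_comp_eq_comp_of_comp_kerι_eq`, ★ `AffineGroupScheme.isMonHom_of_comp_mono`.  The transport direction is the one ★ `AdmIdealTransport` consumes
(`J ↦ J.comap Γ(ε.hom)` : ideals of `Γ(layerκ)` → ideals of `Γ(G₀)`). [cite: Tate1997FiniteFlatGroupSchemes, (3.7)] [cite: Conrad2004GrossZagier, §7 (Thm. 7.5)] -/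
theorem exists_iso_dock_layerR (I : RGDInputsAt F ι₁ Jstar K₀ S hU7ₛ hJ hJu Fi Kc G 𝓜 w hw h𝓨 θ e) [ExpChar (geomResidueField w) I.pChar]
    (𝔡 : ∀ xbar, DockAt I xbar) (y : AlgPoints (S.M.obj Kc) (AlgebraicClosure (w.adicCompletion F))) :
    letI := (𝔡 (red₀Of S Kc 𝓜 w h𝓨 e y)).grp₀
    haveI := isMonHom_transR I y
    ∃ ε : layerκ I y ≅ (𝔡 (red₀Of S Kc 𝓜 w h𝓨 e y)).G₀,
      IsMonHom ε.hom ∧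
      ε.hom ≫ (𝔡 (red₀Of S Kc 𝓜 w h𝓨 e y)).ι₀G ≫ (isoSpecialOf I y).hom = (Over.pullback (sκ w)).map (ιR I y) ∧
      ∀ a : 𝓞 F, (Over.pullback (sκ w)).map (βR I y a) ≫ ε.hom = ε.hom ≫ (𝔡 (red₀Of S Kc 𝓜 w h𝓨 e y)).β₀ a := by
  letI := (𝔡 (red₀Of S Kc 𝓜 w h𝓨 e y)).grp₀
  haveI := isMonHom_transR I y
  -- the dock and the instances of the recipe (LA2-p02 (g0) 05:0xZ)
  let D := 𝔡 (red₀Of S Kc 𝓜 w h𝓨 e y)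
  haveI := isCommMonObj_famOf I y
  haveI : IsCommMonObj ((famOf I y).baseChange (sκ w)).X := isCommMonObj_baseChange _
  haveI := D.hι₀G.1
  haveI : IsClosedImmersion D.ι₀G.left := D.hι₀G.2
  haveI : Mono D.ι₀G := Over.mono_of_mono_left D.ι₀G
  haveI := isMonHom_isoSpecialOf_hom I y
  haveI : Mono (D.ι₀G ≫ (isoSpecialOf I y).hom) := mono_comp _ _
  have hP := (pres_laws w).2.1
  have h𝔭 := (pres_laws w).2.2.2.2.2
  -- (1) the pin `ι₀G ≫ (σ2)` has the kernel-of-`𝔭` clause for the base-changed family (§2.0 glue)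
  have hG' := forall_exists_comp_eq_iff_of_iso (((IsCMField.complexConj F) • w).asIdeal)
    (fun r => ((I.act.baseChange (pullback.fst (𝓜.localise w).total.hom (specResidueField w))).baseChange (red₀Of S Kc 𝓜 w h𝓨 e y).left).i r)
    (fun r => ((actFamOf I y).baseChange (sκ w)).i r) D.ι₀G (isoSpecialOf I y)
    (fun a => (act₀_i_comp_isoSpecialOf_hom I y a).symm) D.hkerG₀
  -- (2) an intertwined action on `(famOf ×_R κ̄)[𝔭]` (★ (S-c-β) `exists_action`)
  have hact := IdealTorsion.exists_action ((actFamOf I y).baseChange (sκ w)) (EOf w) (EOf_idem w) (POf w) hP h𝔭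
  obtain ⟨βκ, hβκ, -⟩ := hact
  -- (3) `β₀` is intertwined along the transported pin
  have hβ' : ∀ a : 𝓞 F, D.β₀ a ≫ (D.ι₀G ≫ (isoSpecialOf I y).hom) =
      (D.ι₀G ≫ (isoSpecialOf I y).hom) ≫ ((actFamOf I y).baseChange (sκ w)).i a := fun a =>
    ((Category.assoc _ _ _).symm.trans (eq_whisker (D.hβ₀G a) _)).trans
      (((Category.assoc _ _ _).trans (whisker_eq D.ι₀G (act₀_i_comp_isoSpecialOf_hom I y a))).trans (Category.assoc _ _ _).symm)
  -- (4) the equivariant comparison iso `e₁ : G₀ ≅ (famOf ×_R κ̄)[𝔭]` over the family (★ (S-c-β) head)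
  have h1 := IdealTorsion.exists_equivariant_iso_of_forall_iff ((actFamOf I y).baseChange (sκ w)) (EOf w) (EOf_idem w) (POf w)
    (D.ι₀G ≫ (isoSpecialOf I y).hom) hP h𝔭 hG' D.β₀ hβ' βκ hβκ
  obtain ⟨e₁, he₁, -⟩ := h1
  -- (5) the base-change iso `eg : layerκ ≅ (famOf ×_R κ̄)[𝔭]` over the family (★ (S-c) §3) and its equivariance (★ (S-c-β) §3)
  have h2 := IdealTorsion.exists_baseChange_iso (actFamOf I y) (EOf w) (EOf_idem w) (POf w) (sκ w) hP
  obtain ⟨eg, heg⟩ := h2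
  have hegβ : ∀ a : 𝓞 F, (Over.pullback (sκ w)).map (βR I y a) ≫ eg.hom = eg.hom ≫ βκ a := fun a =>
    IdealTorsion.pullback_map_comp_eq_comp_of_comp_kerι_eq (actFamOf I y) (EOf w) (EOf_idem w) (POf w) (sκ w) eg.hom heg
      (βR I y a) (βR_comp_ιR I y a) (βκ a) (hβκ a)
  have hinv : ∀ a : 𝓞 F, βκ a ≫ e₁.inv = e₁.inv ≫ D.β₀ a := fun a =>
    IdealTorsion.inv_equivariant_of_iso ((actFamOf I y).baseChange (sκ w)) (EOf w) (EOf_idem w) (POf w)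
      (D.ι₀G ≫ (isoSpecialOf I y).hom) e₁ he₁ (D.β₀ a) (hβ' a) (βκ a) (hβκ a)
  -- (6) homomorphy of the two legs: each is the kernel lift of a homomorphism killing `𝔭` (★ (S-c) `isMonHom_of_comp_kerι_eq`, points clause (i))
  haveI := isMonHom_serreTranslate ((actFamOf I y).baseChange (sκ w)) (EOf w) (EOf_idem w) (POf w)
  have hι₁ : ∀ a ∈ ((IsCMField.complexConj F) • w).asIdeal,
      (D.ι₀G ≫ (isoSpecialOf I y).hom) ≫ ((actFamOf I y).baseChange (sκ w)).i a = 1 :=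
    (IdealTorsion.exists_comp_kerι_eq_iff_forall_mem ((actFamOf I y).baseChange (sκ w)) (EOf w) (EOf_idem w) (POf w) hP h𝔭 _).1
      ⟨e₁.hom, he₁⟩
  haveI : IsMonHom e₁.hom :=
    IdealTorsion.isMonHom_of_comp_kerι_eq ((actFamOf I y).baseChange (sκ w)) (EOf w) (EOf_idem w) (POf w) hP h𝔭
      (D.ι₀G ≫ (isoSpecialOf I y).hom) hι₁ e₁.hom he₁
  have hι₂ : ∀ a ∈ ((IsCMField.complexConj F) • w).asIdeal,
      (Over.pullback (sκ w)).map (ιR I y) ≫ ((actFamOf I y).baseChange (sκ w)).i a = 1 :=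
    (IdealTorsion.exists_comp_kerι_eq_iff_forall_mem ((actFamOf I y).baseChange (sκ w)) (EOf w) (EOf_idem w) (POf w) hP h𝔭 _).1
      ⟨eg.hom, heg⟩
  haveI : IsMonHom eg.hom :=
    IdealTorsion.isMonHom_of_comp_kerι_eq ((actFamOf I y).baseChange (sκ w)) (EOf w) (EOf_idem w) (POf w) hP h𝔭
      ((Over.pullback (sκ w)).map (ιR I y)) hι₂ eg.hom heg
  -- (7) the witness `ε := eg ≪≫ e₁⁻¹`
  refine ⟨eg ≪≫ e₁.symm, ?_, ?_, fun a => ?_⟩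
  · show IsMonHom (eg.hom ≫ e₁.inv)
    infer_instance
  · show (eg.hom ≫ e₁.inv) ≫ D.ι₀G ≫ (isoSpecialOf I y).hom = (Over.pullback (sκ w)).map (ιR I y)
    exact (Category.assoc _ _ _).trans ((whisker_eq eg.hom (e₁.inv_comp_eq.mpr he₁.symm)).trans heg)
  · show (Over.pullback (sκ w)).map (βR I y a) ≫ (eg.hom ≫ e₁.inv) = (eg.hom ≫ e₁.inv) ≫ D.β₀ a
    exact ((Category.assoc _ _ _).symm.trans (eq_whisker (hegβ a) _)).trans
      (((Category.assoc _ _ _).trans (whisker_eq eg.hom (hinv a))).trans (Category.assoc _ _ _).symm)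

end Special

/-! ### §1c the lines at `y` ARE the admissible ideals of the generic fibre `layerΩ I y` (PROVED by LA6-p03 (g2), `sec1c.v2` 27faf808, merged verbatim) -/

section Generic

set_option synthInstance.maxHeartbeats 100000

open Literature.AlgebraicGeometry.GroupSchemes (GroupSchemeKernel.ker GroupSchemeKernel.kerι)
open Literature.AlgebraicGeometry.GroupSchemes.AffineGroupScheme (ptEquiv)

variable {F : Type} [Field F] [NumberField F] [IsCMField F] {ι₁ : F →+* ℂ}
    {Jstar : Matrix (Fin 2) (Fin 2) F}
    {K₀ : C5.OpenCompactSubgroup ↥(finAdelic ↥(maximalRealSubfield F) F (IsCMField.complexConj F) 2 Jstar)}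
    {S : RecordSystemGS F Jstar ι₁ K₀} {hU7ₛ : S.HeckeTranslateDefinedOver}
    {hJ : (Jstar.map (IsCMField.complexConj F))ᵀ = Jstar} {hJu : IsUnit Jstar}
    {Fi : Type} [Field Fi] [Algebra F Fi] {Kc : C5.SmallLevel K₀} {G : Type} [Group G]
    {𝓜 : IntegralModel (𝓞 F) F ((thickening F Fi).obj (S.M.obj Kc))}
    {w : HeightOneSpectrum (𝓞 F)} {hw : (IsCMField.complexConj F) • w ≠ w} {h𝓨 : (𝓜.localise w).IsSmoothProper 1}
    {θ : ActionOver (𝓜.localise w).total.hom ((Fi ≃ₐ[F] Fi) × G)}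
    {e : Fi →ₐ[F] AlgebraicClosure (w.adicCompletion F)}

variable (I : RGDInputsAt F ι₁ Jstar K₀ S hU7ₛ hJ hJu Fi Kc G 𝓜 w hw h𝓨 θ e)

/-! #### §1c-0 the generic layer: finite étale, its inclusion into `(univ ×_𝓨 Spec R) ×_R Ω̄` a monomorphic homomorphism reading the `𝔭_{c•w}`-torsion -/

set_option backward.isDefEq.respectTransparency false in
/-- `layerΩ I y → Spec Ω̄` is finite (base change of the finite `layerR I y → Spec R`). [cite: GortzWedhorn2023, Cor. 27.177 (1)] -/
theorem isFinite_layerΩ_hom (y : AlgPoints (S.M.obj Kc) (AlgebraicClosure (w.adicCompletion F))) : IsFinite (layerΩ I y).hom := by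
  haveI := isFinite_layerR_hom I y
  exact MorphismProperty.pullback_snd _ _ inferInstance

set_option maxHeartbeats 400000 in
open scoped MonObj CategoryTheory.Obj in
set_option backward.isDefEq.respectTransparency false in
/-- **★ (S-c) §3 READ FOR THE LAYER**: `layerΩ I y ≅ (A_Ω̄)[𝔭_{c•w}] = Ker ψ_P(A_Ω̄)` over `A_Ω̄ := (univ ×_𝓨 Spec R) ×_R Ω̄`, compatibly with `(ιR)_Ω̄` and `kerι`
(★ `IdealTorsion.exists_baseChange_iso` at `g := sΩ w`). [cite: GortzWedhorn2020, (4.15), p. 116 and Definition 4.45 (2), p. 117] [cite: Conrad2004GrossZagier, §7 (Thm. 7.5)] -/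
theorem exists_iso_layerΩ_ker (y : AlgPoints (S.M.obj Kc) (AlgebraicClosure (w.adicCompletion F))) :
    haveI := isCommMonObj_famOf I y
    ∃ eg : layerΩ I y ≅
        GroupSchemeKernel.ker (@serreTranslate _ ((famOf I y).baseChange (sΩ w)) (𝓞 F) _ ((actFamOf I y).baseChange (sΩ w))
          (isCommMonObj_baseChange (sΩ w)) (mOf w) (EOf w) (EOf_idem w) (POf w)),
      eg.hom ≫ GroupSchemeKernel.kerι _ = (Over.pullback (sΩ w)).map (ιR I y) := by
  haveI := isCommMonObj_famOf I y
  exact IdealTorsion.exists_baseChange_iso (actFamOf I y) (EOf w) (EOf_idem w) (POf w) (sΩ w) (pres_laws w).2.1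

set_option maxHeartbeats 400000 in
open scoped MonObj CategoryTheory.Obj in
set_option backward.isDefEq.respectTransparency false in
/-- **THE KERNEL-OF-`𝔭` CLAUSE THROUGH `(ιR)_Ω̄`**: a `T`-point `t` of `A_Ω̄ = (univ ×_𝓨 Spec R) ×_R Ω̄` factors through `(ιR)_Ω̄ : layerΩ I y ⟶ A_Ω̄` iff it is killed
by every `ι(a)`, `a ∈ 𝔭_{c•w}` (★ (S-c) `exists_comp_kerι_eq_iff_forall_mem` at the base-changed family, moved along `exists_iso_layerΩ_ker`).
[cite: Conrad2004GrossZagier, §7 (Thm. 7.5)] [cite: GortzWedhorn2020, Definition 4.45 (2), p. 117] -/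
theorem exists_comp_pullback_map_ιR_iff (y : AlgPoints (S.M.obj Kc) (AlgebraicClosure (w.adicCompletion F)))
    {T : Over (Spec (.of (AlgebraicClosure (w.adicCompletion F))))} (t : T ⟶ ((famOf I y).baseChange (sΩ w)).X) :
    (∃ s : T ⟶ layerΩ I y, s ≫ (Over.pullback (sΩ w)).map (ιR I y) = t) ↔
      ∀ a ∈ ((IsCMField.complexConj F) • w).asIdeal, t ≫ ((actFamOf I y).baseChange (sΩ w)).i a = 1 := by
  haveI := isCommMonObj_famOf I y
  haveI : IsCommMonObj ((famOf I y).baseChange (sΩ w)).X := isCommMonObj_baseChange _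
  obtain ⟨eg, heg⟩ := exists_iso_layerΩ_ker I y
  rw [← IdealTorsion.exists_comp_kerι_eq_iff_forall_mem ((actFamOf I y).baseChange (sΩ w)) (EOf w) (EOf_idem w) (POf w)
    (pres_laws w).2.1 (pres_laws w).2.2.2.2.2 t, ← heg]
  constructor
  · rintro ⟨s, hs⟩
    exact ⟨s ≫ eg.hom, by rw [Category.assoc]; exact hs⟩
  · rintro ⟨s', hs'⟩
    exact ⟨s' ≫ eg.inv, by rw [Category.assoc, Iso.inv_hom_id_assoc]; exact hs'⟩

set_option maxHeartbeats 400000 in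
open scoped MonObj CategoryTheory.Obj in
set_option backward.isDefEq.respectTransparency false in
/-- `(ιR)_Ω̄ : layerΩ I y ⟶ A_Ω̄` is a monomorphism (an isomorphism followed by ★ `mono_kerι`). [cite: GortzWedhorn2020, Definition 4.45 (2), p. 117] -/
theorem mono_pullback_map_ιR (y : AlgPoints (S.M.obj Kc) (AlgebraicClosure (w.adicCompletion F))) :
    Mono ((Over.pullback (sΩ w)).map (ιR I y)) := by
  haveI := isCommMonObj_famOf I y
  obtain ⟨eg, heg⟩ := exists_iso_layerΩ_ker I y
  rw [← heg]
  haveI := Literature.AlgebraicGeometry.GroupSchemes.GroupSchemeKernel.mono_kerι (@serreTranslate _ ((famOf I y).baseChange (sΩ w)) (𝓞 F) _ ((actFamOf I y).baseChange (sΩ w))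
    (isCommMonObj_baseChange (sΩ w)) (mOf w) (EOf w) (EOf_idem w) (POf w))
  exact mono_comp _ _

set_option maxHeartbeats 400000 in
open scoped MonObj CategoryTheory.Obj in
set_option backward.isDefEq.respectTransparency false in
/-- **THE GENERIC LAYER IS ÉTALE**: `layerΩ I y → Spec Ω̄` is étale — `(A_Ω̄)[𝔭]` is étale over the characteristic-`0` field `Ω̄` (★ (GF)
`etale_ker_serreTranslate_hom`, `(N : Ω̄) ≠ 0`), and `layerΩ I y ≅ (A_Ω̄)[𝔭]` over `Spec Ω̄`. [cite: MumfordAV1970, §7 Thm. 4 (p. 72)] [cite: GortzWedhorn2023, Prop. 27.187 and Cor. 27.63] -/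
theorem etale_layerΩ_hom (y : AlgPoints (S.M.obj Kc) (AlgebraicClosure (w.adicCompletion F))) : Etale (layerΩ I y).hom := by
  haveI := isCommMonObj_famOf I y
  haveI : IsCommMonObj ((famOf I y).baseChange (sΩ w)).X := isCommMonObj_baseChange _
  have hN : ((NOf w : ℕ) : AlgebraicClosure (w.adicCompletion F)) ≠ 0 := Nat.cast_ne_zero.mpr (pres_laws w).1
  haveI := IdealTorsion.etale_ker_serreTranslate_hom ((actFamOf I y).baseChange (sΩ w)) (EOf w) (EOf_idem w) (POf w) (QOf w)
    hN (pres_laws w).2.1 (pres_laws w).2.2.2.1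
  obtain ⟨eg, -⟩ := exists_iso_layerΩ_ker I y
  haveI : IsIso eg.hom.left := inferInstanceAs (IsIso ((Over.forget _).map eg.hom))
  rw [← Over.w eg.hom]
  infer_instance

set_option maxHeartbeats 400000 in
open scoped MonObj CategoryTheory.Obj in
set_option backward.isDefEq.respectTransparency false in
/-- `(βR a)_Ω̄` and `ι(a)_Ω̄` are INTERTWINED by `(ιR)_Ω̄` (base change of `βR_comp_ιR`). [cite: Kottwitz1992, §5, p. 390] -/
theorem pullback_map_βR_comp (y : AlgPoints (S.M.obj Kc) (AlgebraicClosure (w.adicCompletion F))) (a : 𝓞 F) :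
    (Over.pullback (sΩ w)).map (βR I y a) ≫ (Over.pullback (sΩ w)).map (ιR I y) =
      (Over.pullback (sΩ w)).map (ιR I y) ≫ ((actFamOf I y).baseChange (sΩ w)).i a := by
  rw [← Functor.map_comp, βR_comp_ιR, Functor.map_comp]
  rfl

open scoped MonObj CategoryTheory.Obj in
/-- **`AdmKOf I y J`** — `J ⊂ Γ(layerΩ I y)` is ADMISSIBLE: Hopf over `Ω̄`, corank `q = p^f`, stable under every `Γ((βR a)_Ω̄)` — LITERALLY the hypothesis triple `hJ` of ★ S1
`isHopfIdeal_and_finrank_and_map_le_spI` at `G := layerR I y`, `K := Ω̄`, `β := βR I y`, `r := q` (and of ★ (E-b4′)∕SP-SURJ).  [cite: Tate1997FiniteFlatGroupSchemes, (3.7)]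
[cite: GortzWedhorn2023, §(27.2) (27.2.1) (pp. 606–607)] -/
def AdmKOf (y : AlgPoints (S.M.obj Kc) (AlgebraicClosure (w.adicCompletion F))) (J : Ideal (Alg (layerΩ I y))) : Prop :=
  haveI := isMonHom_transR I y
  haveI := isAffine_layerΩ_left I y
  J.IsHopfIdeal (AlgebraicClosure (w.adicCompletion F)) ∧
    Module.finrank (AlgebraicClosure (w.adicCompletion F)) (Alg (layerΩ I y) ⧸ J) = I.pChar ^ I.fDeg ∧
    ∀ a : 𝓞 F, J.map ((Over.pullback (sΩ w)).map (βR I y a)).left.appTop.hom ≤ J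

set_option maxHeartbeats 400000 in
open scoped MonObj CategoryTheory.Obj in
set_option backward.isDefEq.respectTransparency false in
/-- **e₁ — `LineOf I y` TRANSPORTED ALONG THE CHOSEN GENERIC PRESENTATION ISO** `φ := isoGenericOf I y` (★ (TR) `exists_equiv_stableSubgroups_map` at
`t ↦ t ≫ φ`, equivariance `actΩ_comp_isoGenericOf_hom`): lines of `A_y(Ω̄)` ≃ `𝒪_F`-stable order-`q` subgroups of `A_Ω̄(Ω̄)` killed by `𝔭_{c•w}`, `A_Ω̄ :=
(univ ×_𝓨 Spec R) ×_R Ω̄`; membership: `x ∈ e₁ L ↔ x ≫ φ⁻¹ ∈ L`. [cite: Tate1997FiniteFlatGroupSchemes, (3.7)] [cite: BourbakiAlgebraI1989, Ch. I §4 no. 2 Def. 2–3 and no. 3 Def. 4] -/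
theorem exists_equiv_lineOf_stableSubgroups (y : AlgPoints (S.M.obj Kc) (AlgebraicClosure (w.adicCompletion F))) :
    ∃ E₁ : LineOf I y ≃ {H : Subgroup (specOver (AlgebraicClosure (w.adicCompletion F)) (AlgebraicClosure (w.adicCompletion F)) ⟶ ((famOf I y).baseChange (sΩ w)).X) //
        Nat.card ↥H = I.pChar ^ I.fDeg ∧ (∀ x ∈ H, ∀ a ∈ ((IsCMField.complexConj F) • w).asIdeal, x ≫ ((actFamOf I y).baseChange (sΩ w)).i a = 1) ∧ ∀ a, ∀ x ∈ H, x ≫ ((actFamOf I y).baseChange (sΩ w)).i a ∈ H},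
      ∀ (L : LineOf I y) (x : (specOver (AlgebraicClosure (w.adicCompletion F)) (AlgebraicClosure (w.adicCompletion F)) ⟶ ((famOf I y).baseChange (sΩ w)).X)), x ∈ ((E₁ L).1 : Subgroup (specOver (AlgebraicClosure (w.adicCompletion F)) (AlgebraicClosure (w.adicCompletion F)) ⟶ ((famOf I y).baseChange (sΩ w)).X)) ↔ (x ≫ (isoGenericOf I y).inv : ((fibreΩOf S Kc 𝓜 w e I.univ y).Points (AlgebraicClosure (w.adicCompletion F)))) ∈ L.1 := by
  haveI := isMonHom_isoGenericOf_hom I y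
  have hφ : ∀ r : 𝓞 F, (isoGenericOf I y).hom ≫ ((actFamOf I y).baseChange (sΩ w)).i r = (actΩOf S Kc 𝓜 w e I.univ I.act r y).hom.hom.hom ≫ (isoGenericOf I y).hom :=
    fun r => (actΩ_comp_isoGenericOf_hom I y r).symm
  let eMul : ((fibreΩOf S Kc 𝓜 w e I.univ y).Points (AlgebraicClosure (w.adicCompletion F))) ≃* (specOver (AlgebraicClosure (w.adicCompletion F)) (AlgebraicClosure (w.adicCompletion F)) ⟶ ((famOf I y).baseChange (sΩ w)).X) :=
    { toFun := fun t => t ≫ (isoGenericOf I y).hom, invFun := fun t => t ≫ (isoGenericOf I y).inv,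
      left_inv := fun t => by simp only [Category.assoc, Iso.hom_inv_id, Category.comp_id],
      right_inv := fun t => by simp only [Category.assoc, Iso.inv_hom_id, Category.comp_id],
      map_mul' := fun a b => MonObj.mul_comp a b (isoGenericOf I y).hom }
  haveI : Mono (isoGenericOf I y).hom := ⟨fun g h hgh => (Iso.cancel_iso_hom_right g h (isoGenericOf I y)).mp hgh⟩
  obtain ⟨E₁, hE₁⟩ := Literature.GroupTheory.StableSubgroups.exists_equiv_stableSubgroups_map eMul
    (fun (a : 𝓞 F) (t : ((fibreΩOf S Kc 𝓜 w e I.univ y).Points (AlgebraicClosure (w.adicCompletion F)))) =>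
      (AlgPoints.map (actΩOf S Kc 𝓜 w e I.univ I.act a y).hom.hom.hom t : ((fibreΩOf S Kc 𝓜 w e I.univ y).Points (AlgebraicClosure (w.adicCompletion F)))))
    (fun (a : 𝓞 F) (t : (specOver (AlgebraicClosure (w.adicCompletion F)) (AlgebraicClosure (w.adicCompletion F)) ⟶ ((famOf I y).baseChange (sΩ w)).X)) => t ≫ ((actFamOf I y).baseChange (sΩ w)).i a)
    (fun a t => by
      show (t ≫ (actΩOf S Kc 𝓜 w e I.univ I.act a y).hom.hom.hom) ≫ (isoGenericOf I y).hom = (t ≫ (isoGenericOf I y).hom) ≫ ((actFamOf I y).baseChange (sΩ w)).i a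
      rw [Category.assoc, Category.assoc, hφ a])
    (fun t => IsIdealTorsionΩ S Kc 𝓜 w e I.univ I.act y ((IsCMField.complexConj F) • w).asIdeal t)
    (fun (t : (specOver (AlgebraicClosure (w.adicCompletion F)) (AlgebraicClosure (w.adicCompletion F)) ⟶ ((famOf I y).baseChange (sΩ w)).X)) => ∀ a ∈ ((IsCMField.complexConj F) • w).asIdeal, t ≫ ((actFamOf I y).baseChange (sΩ w)).i a = 1)
    (fun t => by
      show (∀ a ∈ ((IsCMField.complexConj F) • w).asIdeal, t ≫ (actΩOf S Kc 𝓜 w e I.univ I.act a y).hom.hom.hom = 1) ↔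
        ∀ a ∈ ((IsCMField.complexConj F) • w).asIdeal, (t ≫ (isoGenericOf I y).hom) ≫ ((actFamOf I y).baseChange (sΩ w)).i a = 1
      refine forall₂_congr fun a _ => ?_
      rw [Category.assoc, hφ a, ← Category.assoc]
      constructor
      · intro h; rw [h, MonObj.one_comp]
      · intro h; rw [← cancel_mono (isoGenericOf I y).hom, h, MonObj.one_comp])
    (I.pChar ^ I.fDeg)
  refine ⟨E₁, fun L x => ?_⟩
  have h := hE₁ L
  have hx : x ∈ ((E₁ L).1 : Subgroup (specOver (AlgebraicClosure (w.adicCompletion F)) (AlgebraicClosure (w.adicCompletion F)) ⟶ ((famOf I y).baseChange (sΩ w)).X)) ↔ x ∈ L.1.map eMul.toMonoidHom := by rw [h]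
  exact hx.trans Subgroup.mem_map_equiv

set_option maxHeartbeats 400000 in
open scoped MonObj CategoryTheory.Obj in
set_option backward.isDefEq.respectTransparency false in
/-- **e₂ — STABLE SUBGROUPS OF THE LAYER'S POINTS = STABLE `𝔭`-TORSION SUBGROUPS OF `A_Ω̄(Ω̄)`** (★ (UP-ADM) §3 `exists_equiv_subgroup_of_mono` at the
monomorphic homomorphism `j := (ιR)_Ω̄`, intertwining `(βR a)_Ω̄` with `ι(a)_Ω̄` by `pullback_map_βR_comp`; the image clause `∃ s, s ≫ j = x` rewritten as
«killed by `𝔭_{c•w}`» by `exists_comp_pullback_map_ιR_iff`); membership: `s ≫ j ∈ e₂ H′ ↔ s ∈ H′`. [cite: Tate1997FiniteFlatGroupSchemes, (3.7)]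
[cite: GortzWedhorn2023, §(27.2) (p. 606)] -/
theorem exists_equiv_layerSubgroups_stableSubgroups (y : AlgPoints (S.M.obj Kc) (AlgebraicClosure (w.adicCompletion F))) :
    haveI := isMonHom_transR I y
    ∃ E₂ : {H' : Subgroup (specOver (AlgebraicClosure (w.adicCompletion F)) (AlgebraicClosure (w.adicCompletion F)) ⟶ layerΩ I y) //
        Nat.card ↥H' = I.pChar ^ I.fDeg ∧ ∀ a, ∀ x ∈ H', x ≫ (Over.pullback (sΩ w)).map (βR I y a) ∈ H'} ≃ {H : Subgroup (specOver (AlgebraicClosure (w.adicCompletion F)) (AlgebraicClosure (w.adicCompletion F)) ⟶ ((famOf I y).baseChange (sΩ w)).X) //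
        Nat.card ↥H = I.pChar ^ I.fDeg ∧ (∀ x ∈ H, ∀ a ∈ ((IsCMField.complexConj F) • w).asIdeal, x ≫ ((actFamOf I y).baseChange (sΩ w)).i a = 1) ∧ ∀ a, ∀ x ∈ H, x ≫ ((actFamOf I y).baseChange (sΩ w)).i a ∈ H},
      ∀ (H' : {H' : Subgroup (specOver (AlgebraicClosure (w.adicCompletion F)) (AlgebraicClosure (w.adicCompletion F)) ⟶ layerΩ I y) //
        Nat.card ↥H' = I.pChar ^ I.fDeg ∧ ∀ a, ∀ x ∈ H', x ≫ (Over.pullback (sΩ w)).map (βR I y a) ∈ H'}) (s : (specOver (AlgebraicClosure (w.adicCompletion F)) (AlgebraicClosure (w.adicCompletion F)) ⟶ layerΩ I y)), s ≫ ((Over.pullback (sΩ w)).map (ιR I y)) ∈ ((E₂ H').1 : Subgroup (specOver (AlgebraicClosure (w.adicCompletion F)) (AlgebraicClosure (w.adicCompletion F)) ⟶ ((famOf I y).baseChange (sΩ w)).X)) ↔ s ∈ (H'.1 : Subgroup (specOver (AlgebraicClosure (w.adicCompletion F)) (AlgebraicClosure (w.adicCompletion F)) ⟶ layerΩ I y))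 := by
  haveI := isMonHom_transR I y
  haveI := mono_pullback_map_ιR I y
  haveI : IsMonHom (M := layerΩ I y) (N := ((famOf I y).baseChange (sΩ w)).X) ((Over.pullback (sΩ w)).map (ιR I y)) :=
    inferInstanceAs (IsMonHom ((Over.pullback (sΩ w)).map (ιR I y)))
  obtain ⟨E₂, hE₂⟩ := Literature.AlgebraicGeometry.GroupSchemes.EtaleIdealPoints.exists_equiv_subgroup_of_mono (k := (AlgebraicClosure (w.adicCompletion F)))
    ((Over.pullback (sΩ w)).map (ιR I y)) (fun a => (Over.pullback (sΩ w)).map (βR I y a)) (fun a => ((actFamOf I y).baseChange (sΩ w)).i a)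
    (fun a => pullback_map_βR_comp I y a) (I.pChar ^ I.fDeg)
  -- the image clause `∃ s, s ≫ j = x` IS the `𝔭`-torsion clause; reorder the conjuncts
  have hiff : ∀ H : Subgroup (specOver (AlgebraicClosure (w.adicCompletion F)) (AlgebraicClosure (w.adicCompletion F)) ⟶ ((famOf I y).baseChange (sΩ w)).X),
      (Nat.card ↥H = I.pChar ^ I.fDeg ∧ (∀ a, ∀ x ∈ H, x ≫ (fun a => ((actFamOf I y).baseChange (sΩ w)).i a) a ∈ H) ∧
          ∀ x ∈ H, ∃ s : (specOver (AlgebraicClosure (w.adicCompletion F)) (AlgebraicClosure (w.adicCompletion F)) ⟶ layerΩ I y), s ≫ ((Over.pullback (sΩ w)).map (ιR I y)) = x) ↔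
      (Nat.card ↥H = I.pChar ^ I.fDeg ∧ (∀ x ∈ H, ∀ a ∈ ((IsCMField.complexConj F) • w).asIdeal, x ≫ ((actFamOf I y).baseChange (sΩ w)).i a = 1) ∧ ∀ a, ∀ x ∈ H, x ≫ ((actFamOf I y).baseChange (sΩ w)).i a ∈ H) := fun H =>
    ⟨fun h => ⟨h.1, fun x hx => (exists_comp_pullback_map_ιR_iff I y x).1 (h.2.2 x hx), h.2.1⟩,
      fun h => ⟨h.1, h.2.2, fun x hx => (exists_comp_pullback_map_ιR_iff I y x).2 (h.2.1 x hx)⟩⟩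
  refine ⟨E₂.trans (Equiv.subtypeEquivRight hiff), fun H' s => ?_⟩
  rw [Equiv.trans_apply]
  exact hE₂ H' s

set_option maxHeartbeats 400000 in
open scoped MonObj CategoryTheory.Obj in
set_option backward.isDefEq.respectTransparency false in
/-- **§1c `exists_equiv_lineOf_admK` — THE LINES AT `y` ARE THE ADMISSIBLE IDEALS OF `layerΩ I y`, WITH THE MEMBERSHIP LAW**: a bijection `eL : LineOf I y ≃ {J ∕∕ AdmKOf I y J}`
(`η` is MonObj notation, hence the name) under which a point `s` of the generic layer kills `eL L` iff its image `s ≫ (ιR)_Ω̄ ≫ (σ3)⁻¹` in `A_y(Ω̄)` lies on the line `L` — (σ3) `isoGenericOf` (equivariant), ★ (S-c) §3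
`exists_baseChange_iso` + §1 kernel-of-`𝔭` clause (`exists_comp_kerι_eq_iff_forall_mem`) for «killed by `𝔭_{c•w}`» ↔ «factors through the layer», ★ (UP-ADM) §3
`exists_equiv_subgroup_of_mono` and HEAD `exists_equiv_admissible` on the finite ÉTALE `layerΩ I y` (★ (GF) `etale_ker_serreTranslate_hom`, `NOf w ≠ 0` in `Ω̄` of
characteristic `0`; `Ω̄` algebraically closed).  Statement first. [cite: Tate1997FiniteFlatGroupSchemes, (3.7)] [cite: GortzWedhorn2023, §(27.2) (27.2.1) (p. 607)] -/
theorem exists_equiv_lineOf_admK (y : AlgPoints (S.M.obj Kc) (AlgebraicClosure (w.adicCompletion F))) :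
    haveI := isMonHom_transR I y
    haveI := isAffine_layerΩ_left I y
    ∃ eL : LineOf I y ≃ {J : Ideal (Alg (layerΩ I y)) // AdmKOf I y J},
      ∀ (L : LineOf I y) (s : specOver (AlgebraicClosure (w.adicCompletion F)) (AlgebraicClosure (w.adicCompletion F)) ⟶ layerΩ I y),
        (eL L).1 ≤ RingHom.ker (ptEquiv (layerΩ I y) (AlgebraicClosure (w.adicCompletion F)) s).toRingHom ↔
          (s ≫ (Over.pullback (sΩ w)).map (ιR I y) ≫ (isoGenericOf I y).inv :
            (fibreΩOf S Kc 𝓜 w e I.univ y).Points (AlgebraicClosure (w.adicCompletion F))) ∈ L.1 := by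
  haveI := isMonHom_transR I y
  haveI := isAffine_layerΩ_left I y
  haveI := isFinite_layerΩ_hom I y
  haveI := etale_layerΩ_hom I y
  -- e₁ (★ (TR)), e₂ (★ (UP-ADM) §3), e₃ (★ (UP-ADM) HEAD on the finite ÉTALE layer)
  obtain ⟨E₁, hE₁⟩ := exists_equiv_lineOf_stableSubgroups I y
  obtain ⟨E₂, hE₂⟩ := exists_equiv_layerSubgroups_stableSubgroups I y
  obtain ⟨E₃, hE₃⟩ := Literature.AlgebraicGeometry.GroupSchemes.EtaleIdealPoints.exists_equiv_admissible (k := (AlgebraicClosure (w.adicCompletion F)))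
    (layerΩ I y) (fun a => (Over.pullback (sΩ w)).map (βR I y a)) (I.pChar ^ I.fDeg)
  refine ⟨E₁.trans (E₂.symm.trans E₃), fun L s => ?_⟩
  have h3 := hE₃ (E₂.symm (E₁ L)) s
  have h2 := hE₂ (E₂.symm (E₁ L)) s
  rw [Equiv.apply_symm_apply] at h2
  have h1 := hE₁ L (s ≫ (Over.pullback (sΩ w)).map (ιR I y))
  exact h3.trans (h2.symm.trans (h1.trans (Iff.of_eq (by rw [Category.assoc]))))

end Generic


/-! (★ re-home, size lint: PART 4 of 6 ends here at tree line :1285; continued in `Theorems/F0P6aLineSpecialisationLaws.lean`.) -/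

end Summit.HodgeConjecture.HodgeConjecture.Cruxes.HLiu418.F0P6aLineSpecialisation
end
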